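import Literature.MeasureTheory.Covering.DyadicSelection
import Mathlib.Analysis.SpecialFunctions.Log.Basic
import HarnessLib

/-!
# Gilbarg–Trudinger Lemma 9.23 (the measure-to-supremum growth lemma of Krylov–Safonov)

On the unit cube `K₀ = [0,1)ⁿ`, let `w` be measurable and `Γ_k = {x ∈ K₀ | w x ≤ k}`. Suppose there
are `0 < δ < 1` and `C ≥ 0` such that, whenever a dyadic cube `K = Q_{j,m} ⊆ K₀` (centre `z`,
half-side `r`) satisfies `|Γ_k ∩ K| ≥ δ|K|`, one has `w ≤ k + C` on `K₀ ∩ K̄_{3r}(z)`. Then for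
every `k` with `|Γ_k| > 0`,
`sup_{K₀} (w - k) ≤ C (1 + log |Γ_k| / log δ)` (`sub_le_of_cube_condition`, GT (9.59)).

We follow the printed proof: induction on `m` in "`|Γ_k| ≥ δ^m ⇒ sup_{K₀}(w-k) ≤ mC`", the step
being the cube decomposition (9.20) (`volume_le_mul_volume_parentUnion`): the parents `K̃` of the
selected cubes lie in `K₀ ∩ K̄_{3r}(z)` (`parent_subset_closedBall`), hence in `Γ_{k+C}`, so
`|Γ_{k+C}| ≥ |F̃| ≥ |Γ_k|/δ`. Differences from the book, all on the safe side: the hypothesis is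
only required for DYADIC sub-cubes (the only ones the proof uses), with the closed cube `K̄_{3r}`
(the parent may touch its boundary), and suprema are pointwise.

## References

* D. Gilbarg, N. S. Trudinger, *Elliptic Partial Differential Equations of Second Order* (2001),
  Lemma 9.23, (9.57)–(9.59). [GilbargTrudinger2001]
-/

noncomputable section

open Set MeasureTheory Metric Filter
open scoped ENNReal

namespace Literature.MeasureTheory.Covering.Dyadic

variable {ι : Type*} [Fintype ι]

/-- The sublevel set `Γ_k = {x ∈ K₀ | w x ≤ k}`. [cite: GilbargTrudinger2001, Lemma 9.23] -/
def subLevel (w : (ι → ℝ) → ℝ) (k : ℝ) : Set (ι → ℝ) := dyadicCube 0 0 ∩ {x | w x ≤ k}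

omit [Fintype ι] in
/-- `Γ_k ⊆ K₀`. [folklore] -/
theorem subLevel_subset (w : (ι → ℝ) → ℝ) (k : ℝ) : subLevel w k ⊆ dyadicCube 0 0 :=
  inter_subset_left

/-- `Γ_k` is measurable for measurable `w`. [folklore] -/
theorem measurableSet_subLevel {w : (ι → ℝ) → ℝ} (hw : Measurable w) (k : ℝ) :
    MeasurableSet (subLevel w k) :=
  (measurableSet_dyadicCube 0 0).inter (hw measurableSet_Iic)

/-- `|Γ_k| ≤ |K₀| = 1`. [folklore] -/
theorem volume_subLevel_le_one (w : (ι → ℝ) → ℝ) (k : ℝ) : volume (subLevel w k) ≤ 1 := by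
  calc volume (subLevel w k) ≤ volume (dyadicCube (ι := ι) 0 0) := measure_mono (subLevel_subset w k)
    _ = 1 := by rw [volume_dyadicCube]; simp

/-- **The cube condition (9.57)–(9.58)**, dyadic form: whenever a dyadic `K = Q_{j,m} ⊆ K₀` has
`|Γ_k ∩ K| ≥ δ|K|`, then `w ≤ k + C` on `K₀ ∩ K̄_{3r}(z)` (`z` the centre, `r = 2^{-j}/2` the
half-side of `K`). [cite: GilbargTrudinger2001, Lemma 9.23, (9.57)–(9.58)] -/
def CubeCondition (w : (ι → ℝ) → ℝ) (δ C : ℝ) : Prop :=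
  ∀ (k : ℝ) (j : ℕ) (m : ι → ℤ), dyadicCube j m ⊆ dyadicCube 0 0 →
    ENNReal.ofReal δ * volume (dyadicCube j m) ≤ volume (subLevel w k ∩ dyadicCube j m) →
    ∀ x ∈ dyadicCube 0 0 ∩ closedBall (centre j m) (3 * ((2 ^ j)⁻¹ / 2)), w x ≤ k + C

/-- **A parent lies in the closed triple cube of its child**: `Q_{j,⌊m/2⌋} ⊆ K̄_{3r}(z)` for the
child `Q_{j+1,m}` with centre `z` and half-side `r = 2^{-(j+1)}/2`.
[cite: GilbargTrudinger2001, proof of Lemma 9.23 (`K̃ ⊆ K_{3r}(z)`)] -/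
theorem parent_subset_closedBall (j : ℕ) (m : ι → ℤ) :
    dyadicCube j (parentIndex m) ⊆ closedBall (centre (j + 1) m) (3 * ((2 ^ (j + 1))⁻¹ / 2)) := by
  intro y hy
  have hr : (0 : ℝ) ≤ 3 * ((2 ^ (j + 1))⁻¹ / 2) := by positivity
  rw [mem_closedBall, dist_pi_le_iff hr]
  intro i
  rw [Real.dist_eq, abs_le]
  obtain ⟨h1, h2⟩ := (mem_dyadicCube.1 hy) i
  have h2j : (0 : ℝ) < 2 ^ j := by positivity
  -- integer bounds on the parent index
  have hdiv : ((m i / 2 : ℤ) : ℝ) * 2 ≤ m i := by exact_mod_cast Int.ediv_mul_le (m i) two_ne_zero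
  have hlt : (m i : ℝ) + 1 ≤ ((m i / 2 : ℤ) : ℝ) * 2 + 2 := by
    have h : m i < (m i / 2 + 1) * 2 := by
      have := Int.lt_ediv_add_one_mul_self (m i) (by norm_num : (0 : ℤ) < 2); linarith
    have h' : m i + 1 ≤ (m i / 2 + 1) * 2 := h
    have := (Int.cast_le (R := ℝ)).2 h'
    push_cast at this
    linarith
  simp only [parentIndex] at h1 h2
  have ec : centre (j + 1) m i = ((m i : ℝ) + 1 / 2) / 2 ^ (j + 1) := rfl
  rw [ec, pow_succ] at *
  rw [div_le_iff₀ h2j] at h1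
  rw [lt_div_iff₀ h2j] at h2
  have h2j1 : (0 : ℝ) < 2 ^ j * 2 := by positivity
  constructor
  · -- `c - 3r ≤ y`, i.e. `(m - 1)/2^{j+1} ≤ y`
    have key : ((m i : ℝ) + 1 / 2) / (2 ^ j * 2) - 3 * ((2 ^ j * 2)⁻¹ / 2) = ((m i : ℝ) - 1) / (2 ^ j * 2) := by
      field_simp; ring
    have hy : ((m i : ℝ) - 1) / (2 ^ j * 2) ≤ y i := by
      rw [div_le_iff₀ h2j1]; nlinarith
    linarith
  · have key : ((m i : ℝ) + 1 / 2) / (2 ^ j * 2) + 3 * ((2 ^ j * 2)⁻¹ / 2) = ((m i : ℝ) + 2) / (2 ^ j * 2) := by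
      field_simp; ring
    have hy : y i ≤ ((m i : ℝ) + 2) / (2 ^ j * 2) := by
      rw [le_div_iff₀ h2j1]; nlinarith
    linarith

/-- **Top level**: if `|Γ_k| ≥ δ = δ|K₀|`, the cube condition at `K = K₀` gives `w ≤ k + C` on
`K₀`. [cite: GilbargTrudinger2001, proof of Lemma 9.23 (case `m = 1`)] -/
theorem le_of_volume_ge {w : (ι → ℝ) → ℝ} {δ C : ℝ} (hcc : CubeCondition w δ C) {k : ℝ}
    (hk : ENNReal.ofReal δ ≤ volume (subLevel w k)) : ∀ x ∈ dyadicCube (ι := ι) 0 0, w x ≤ k + C := by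
  intro x hx
  refine hcc k 0 0 subset_rfl ?_ x ⟨hx, ?_⟩
  · rw [inter_eq_left.2 (subLevel_subset w k), volume_dyadicCube]
    simpa using hk
  · have h := dyadicCube_subset_closedBall 0 0 hx
    rw [mem_closedBall] at h ⊢
    linarith

/-- **One decomposition step**: if `|Γ_k| ≤ δ`, then `|Γ_k| ≤ δ |Γ_{k+C}|` — by (9.20) and
because every parent of a selected cube lies in `Γ_{k+C}`.
[cite: GilbargTrudinger2001, proof of Lemma 9.23 (induction step)] -/
theorem volume_le_mul_volume_subLevel_add {w : (ι → ℝ) → ℝ} (hw : Measurable w) {δ C : ℝ}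
    (hδ1 : δ < 1) (hcc : CubeCondition w δ C) {k : ℝ}
    (hk : volume (subLevel w k) ≤ ENNReal.ofReal δ) :
    volume (subLevel w k) ≤ ENNReal.ofReal δ * volume (subLevel w (k + C)) := by
  set t := ENNReal.ofReal δ with ht
  have ht1 : t < 1 := ENNReal.ofReal_lt_one.2 hδ1
  have h920 := volume_le_mul_volume_parentUnion ht1 (measurableSet_subLevel hw k)
    (subLevel_subset w k) hk
  refine h920.trans (mul_le_mul_right (measure_mono ?_) _)
  -- `F̃ ⊆ Γ_{k+C}`
  intro y hy
  simp only [parentUnion, mem_iUnion] at hy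
  obtain ⟨j, m, hp, hy⟩ := hy
  obtain ⟨-, hPK₀, -⟩ := hp.not_isDense_and_subset
  obtain ⟨m', hs, hpm⟩ := hp
  refine ⟨hPK₀ hy, ?_⟩
  show w y ≤ k + C
  refine hcc k (j + 1) m' hs.1 (le_of_lt hs.2.1) y ⟨hPK₀ hy, ?_⟩
  rw [← hpm] at hy
  exact parent_subset_closedBall j m' hy

/-- **The induction** `|Γ_k| ≥ δⁿ ⇒ sup_{K₀} (w - k) ≤ nC` (`n ≥ 1`).
[cite: GilbargTrudinger2001, proof of Lemma 9.23] -/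
theorem le_of_volume_ge_pow {w : (ι → ℝ) → ℝ} (hw : Measurable w) {δ C : ℝ} (hδ0 : 0 < δ)
    (hδ1 : δ < 1) (hC : 0 ≤ C) (hcc : CubeCondition w δ C) (n : ℕ) (hn : 1 ≤ n) :
    ∀ k : ℝ, ENNReal.ofReal (δ ^ n) ≤ volume (subLevel w k) →
      ∀ x ∈ dyadicCube (ι := ι) 0 0, w x ≤ k + n * C := by
  induction n, hn using Nat.le_induction with
  | base =>
    intro k hk x hx
    simpa using le_of_volume_ge hcc (by simpa using hk) x hx
  | succ n hn ih =>
    intro k hk x hx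
    by_cases hbig : ENNReal.ofReal δ ≤ volume (subLevel w k)
    · have h := le_of_volume_ge hcc hbig x hx
      have : (C : ℝ) ≤ (↑(n + 1) : ℝ) * C := by
        have : (1 : ℝ) ≤ (↑(n + 1) : ℝ) := by exact_mod_cast Nat.succ_le_succ (Nat.zero_le n)
        nlinarith
      linarith
    · push Not at hbig
      have hstep := volume_le_mul_volume_subLevel_add hw hδ1 hcc hbig.le
      have hk' : ENNReal.ofReal (δ ^ n) ≤ volume (subLevel w (k + C)) := by
        have h1 : ENNReal.ofReal δ * ENNReal.ofReal (δ ^ n) ≤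
            ENNReal.ofReal δ * volume (subLevel w (k + C)) := by
          calc ENNReal.ofReal δ * ENNReal.ofReal (δ ^ n) = ENNReal.ofReal (δ ^ (n + 1)) := by
                rw [← ENNReal.ofReal_mul hδ0.le, pow_succ']
            _ ≤ _ := hk.trans hstep
        exact (ENNReal.mul_le_mul_iff_right ((ENNReal.ofReal_pos.2 hδ0).ne') ENNReal.ofReal_ne_top).1 h1
      have h := ih (k + C) hk' x hx
      push_cast at h ⊢
      linarith

/-- **Gilbarg–Trudinger Lemma 9.23** (unit cube, dyadic cube condition): under the cube condition
with constants `0 < δ < 1`, `C ≥ 0`, for every level `k` with `|Γ_k| > 0`,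
`w x - k ≤ C (1 + log |Γ_k| / log δ)` for all `x ∈ K₀`. [cite: GilbargTrudinger2001, Lemma 9.23, (9.59)] -/
theorem sub_le_of_cube_condition {w : (ι → ℝ) → ℝ} (hw : Measurable w) {δ C : ℝ} (hδ0 : 0 < δ)
    (hδ1 : δ < 1) (hC : 0 ≤ C) (hcc : CubeCondition w δ C) {k : ℝ}
    (hk : 0 < volume (subLevel w k)) {x : ι → ℝ} (hx : x ∈ dyadicCube (ι := ι) 0 0) :
    w x - k ≤ C * (1 + Real.log (volume (subLevel w k)).toReal / Real.log δ) := by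
  set V := (volume (subLevel w k)).toReal with hV
  have hfin : volume (subLevel w k) ≠ ∞ :=
    ne_top_of_le_ne_top ENNReal.one_ne_top (volume_subLevel_le_one w k)
  have hVpos : 0 < V := ENNReal.toReal_pos hk.ne' hfin
  have hV1 : V ≤ 1 := by
    have := ENNReal.toReal_mono ENNReal.one_ne_top (volume_subLevel_le_one w k)
    simpa [hV] using this
  have hlogδ : Real.log δ < 0 := Real.log_neg hδ0 hδ1
  have hlogV : Real.log V ≤ 0 := Real.log_nonpos hVpos.le hV1
  set ρ := Real.log V / Real.log δ with hρ
  have hρ0 : 0 ≤ ρ := div_nonneg_of_nonpos hlogV hlogδ.le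
  -- `n = max 1 ⌈ρ⌉₊` satisfies `δⁿ ≤ V` and `n ≤ 1 + ρ`
  set n := max 1 ⌈ρ⌉₊ with hn
  have hn1 : 1 ≤ n := le_max_left _ _
  have hnρ : ρ ≤ n := (Nat.le_ceil ρ).trans (by exact_mod_cast le_max_right 1 ⌈ρ⌉₊)
  have hnle : (n : ℝ) ≤ 1 + ρ := by
    rcases le_or_gt ⌈ρ⌉₊ 1 with h | h
    · have : n = 1 := by rw [hn, max_eq_left h]
      rw [this]; push_cast; linarith
    · have : n = ⌈ρ⌉₊ := by rw [hn, max_eq_right h.le]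
      rw [this]
      have := Nat.ceil_lt_add_one hρ0
      linarith
  have hpow : δ ^ n ≤ V := by
    rw [← Real.log_le_log_iff (pow_pos hδ0 n) hVpos, Real.log_pow]
    have : ρ ≤ n := hnρ
    rw [hρ, div_le_iff_of_neg hlogδ] at this
    exact this
  have hk' : ENNReal.ofReal (δ ^ n) ≤ volume (subLevel w k) := by
    rw [ENNReal.ofReal_le_iff_le_toReal hfin]; exact hpow
  have h := le_of_volume_ge_pow hw hδ0 hδ1 hC hcc n hn1 k hk' x hx
  have : (n : ℝ) * C ≤ C * (1 + ρ) := by nlinarith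
  linarith

end Literature.MeasureTheory.Covering.Dyadic

end
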